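import Summits.QuantumFields.YangMills.Theorems.SwapVirialDeficitZeroModeGroupThreeSmallBallCone
import HarnessLib

/-!
# Exact zero-mode rung Z4 in SMALL-BALL form, three letters — II: the EXACT `t⁴`-scaling identity
# (LEAD ym-line-sfw-p2 g93 07:46Z «EXACT small-ball asymptotics `Haar³{N₃(t)} = v₃t⁴(1+O(t^θ))`»; free-hands support of ⟨stmt-QuantumFields-24197⟩)

Sequel of `…SmallBallCone` (events `tripleBall`, `conePairSet`, `phiCone`, `rescaledSet`, `dilNormSq`; hub/axis reduction).  Here the two non-hub
letters are blown up in their `(J,K)`-directions by w2 g55's transverse dilation ✓`ZeroModeGroup.dilate t` (✓`lintegral_eq_sq_mul_lintegral_comp_dilate`,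
Jacobian `t²` each):
* §4 `phiCone_eq_lintegral_lintegral` (the section as an iterated ball-indicator integral); ★ `dilate_mem_conePairSet_iff` — for `t > 0` and an
  AXIS hub, `[D_tx ∈ B ∧ D_ty ∈ B ∧ (D_tx, D_ty) ∈ conePairSet t a] ↔ (x,y) ∈ rescaledSet t² a` (the factors `t²` cancel EXACTLY, degenerate
  points included); ★★ `phiCone_axis_eq_scaled` — `φ_t(a) = coneConst²·t⁴·∫∫ 𝟙_{rescaledSet t² a}`; joint measurability in the hub;
  ★★ `haar_tripleBall_eq_scaled` — `Haar³(N₃(t)) = t⁴·coneConst²·∫dcone(a)∫∫𝟙_{G_{t²}(re a + ‖Im a‖·i)}(x,y) dx dy` for every `t > 0`: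
  the small-ball order `t⁴` is factored out EXACTLY and the remaining event is `t`-REGULAR (`t` enters only through `s = t²`).
Parts III–IV: the limit event `G₀`, null boundaries, domination by `e³·`(w2's dominator), dominated convergence ⇒ `Haar³(N₃(t))/t⁴ → v₃′ > 0`.
HONEST LABEL: finite-dimensional measure theory on `SU(2)³` (plan-level zero-mode rung of a DRAFT line); NOT the fixed-`L` sharp law of `F^S`, NOT
⟨24197⟩; the Yang–Mills mass gap is NOT proved; no summit is proved by a line.  Seat ym-line-fcl-p3 g44 (cell ym-idea-1, free hands),
`--supports stmt-QuantumFields-24197`.  THEOREMS ONLY (0 `def`, 0 `sorry`), standard axioms; the three local instances of the ToronLog files.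
References: [cite: GonzalezarroyoAltes1988]; [cite: Vanbaal2001]; [folklore].
-/

set_option autoImplicit false

noncomputable section

open MeasureTheory Quaternion Set
open scoped Quaternion ENNReal BigOperators
open Literature.MathematicalPhysics.QuantumLattice
open Literature.MathematicalPhysics.QuantumFieldTheory (haarProbability)
open Literature.MathematicalPhysics.QuantumFieldTheory.Balaban1983to89.T4HaarSU2Translate (su2Quat_quatToSU2 measurable_su2Quat)
open Summit.QuantumFields.YangMills.Theorems.SwapTwistDeficit.ToronLog

attribute [local instance] Literature.Analysis.FluidPDE.Tao2016.quatMeasurableSpace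
  Literature.Analysis.FluidPDE.Tao2016.quatBorelSpace
  Literature.MathematicalPhysics.QuantumLattice.secondCountableTopology_su2

namespace Summit.QuantumFields.YangMills.Theorems.SwapVirialDeficit.ZeroModeGroup
/-! ## §4 The exact `t⁴`-scaling at an axis hub -/

/-- The section as an iterated ball-indicator Lebesgue integral: `φ_t(a) = coneConst²·∫ 𝟙_B(x)·(∫ 𝟙_B(y)·𝟙_{S}(x,y) dy) dx`. [folklore] -/
theorem phiCone_eq_lintegral_lintegral (t : ℝ) (a : ℍ) :
    phiCone t a = ENNReal.ofReal coneConst * (ENNReal.ofReal coneConst *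
      ∫⁻ x, (Metric.ball (0 : ℍ) 1).indicator
        (fun x => ∫⁻ y, (Metric.ball (0 : ℍ) 1).indicator (fun y => (conePairSet t a).indicator (1 : ℍ × ℍ → ℝ≥0∞) (x, y)) y) x) := by
  haveI := isProbabilityMeasure_coneMeasure
  have hF : Measurable fun p : ℍ × ℍ => (conePairSet t a).indicator (1 : ℍ × ℍ → ℝ≥0∞) p :=
    measurable_one.indicator (measurableSet_conePairSet t a)
  rw [phiCone, ← lintegral_indicator_one (measurableSet_conePairSet t a), lintegral_prod _ hF.aemeasurable]
  have hin : ∀ x, ∫⁻ y, (conePairSet t a).indicator (1 : ℍ × ℍ → ℝ≥0∞) (x, y) ∂coneMeasure =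
      ENNReal.ofReal coneConst * ∫⁻ y, (Metric.ball (0 : ℍ) 1).indicator (fun y => (conePairSet t a).indicator (1 : ℍ × ℍ → ℝ≥0∞) (x, y)) y :=
    fun x => lintegral_coneMeasure_eq _
  simp_rw [hin]
  have hmeas : Measurable fun x => ∫⁻ y, (Metric.ball (0 : ℍ) 1).indicator (fun y => (conePairSet t a).indicator (1 : ℍ × ℍ → ℝ≥0∞) (x, y)) y := by
    have h2 : Measurable fun p : ℍ × ℍ => (Metric.ball (0 : ℍ) 1).indicator (fun y => (conePairSet t a).indicator (1 : ℍ × ℍ → ℝ≥0∞) (p.1, y)) p.2 := by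
      have e : (fun p : ℍ × ℍ => (Metric.ball (0 : ℍ) 1).indicator (fun y => (conePairSet t a).indicator (1 : ℍ × ℍ → ℝ≥0∞) (p.1, y)) p.2) =
          (Set.univ ×ˢ Metric.ball (0 : ℍ) 1).indicator (fun p : ℍ × ℍ => (conePairSet t a).indicator (1 : ℍ × ℍ → ℝ≥0∞) p) := by
        funext p
        by_cases hp : p.2 ∈ Metric.ball (0 : ℍ) 1
        · rw [Set.indicator_of_mem hp, Set.indicator_of_mem (Set.mk_mem_prod (Set.mem_univ _) hp)]
        · rw [Set.indicator_of_notMem hp, Set.indicator_of_notMem (fun h => hp h.2)]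
      rw [e]
      exact hF.indicator (MeasurableSet.univ.prod measurableSet_ball)
    exact h2.lintegral_prod_right'
  rw [lintegral_const_mul _ hmeas, lintegral_coneMeasure_eq _]

/-- **The rescaled event, pointwise**: for `t > 0` and an AXIS hub `a` (`a_J = a_K = 0`),
`[D_t x ∈ B ∧ D_t y ∈ B ∧ (D_t x, D_t y) ∈ conePairSet t a] ↔ (x, y) ∈ rescaledSet t² a` — the factors `t²` cancel EXACTLY,
including at the degenerate points (both sides hold when a numerator and its denominator vanish together). [folklore] -/
theorem dilate_mem_conePairSet_iff {t : ℝ} (ht : 0 < t) {a : ℍ} (hJ : a.imJ = 0) (hK : a.imK = 0) (x y : ℍ) :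
    (dilate t x ∈ Metric.ball (0 : ℍ) 1 ∧ dilate t y ∈ Metric.ball (0 : ℍ) 1 ∧ (dilate t x, dilate t y) ∈ conePairSet t a) ↔
      (x, y) ∈ rescaledSet (t ^ 2) a := by
  have ht2 : 0 < t ^ 2 := by positivity
  have hNx : ‖dilate t x‖ ^ 2 = dilNormSq (t ^ 2) x := (dilNormSq_sq_eq t x).symm
  have hNy : ‖dilate t y‖ ^ 2 = dilNormSq (t ^ 2) y := (dilNormSq_sq_eq t y).symm
  have hballx : dilate t x ∈ Metric.ball (0 : ℍ) 1 ↔ dilNormSq (t ^ 2) x < 1 := by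
    rw [Metric.mem_ball, dist_zero_right, ← hNx]
    constructor
    · intro h; nlinarith [norm_nonneg (dilate t x)]
    · intro h; nlinarith [norm_nonneg (dilate t x)]
  have hbally : dilate t y ∈ Metric.ball (0 : ℍ) 1 ↔ dilNormSq (t ^ 2) y < 1 := by
    rw [Metric.mem_ball, dist_zero_right, ← hNy]
    constructor
    · intro h; nlinarith [norm_nonneg (dilate t y)]
    · intro h; nlinarith [norm_nonneg (dilate t y)]
  -- the three normalised commutators after dilation
  have hxy : commSq (dilate t x) (dilate t y) ≤ t ^ 2 ↔
      4 * ((x.imK * y.imI - x.imI * y.imK) ^ 2 + (x.imI * y.imJ - x.imJ * y.imI) ^ 2 + t ^ 2 * (x.imJ * y.imK - x.imK * y.imJ) ^ 2) ≤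
        dilNormSq (t ^ 2) x * dilNormSq (t ^ 2) y := by
    rw [commSq_def, norm_comm_dilate_sq, hNx, hNy]
    set A := 4 * ((x.imK * y.imI - x.imI * y.imK) ^ 2 + (x.imI * y.imJ - x.imJ * y.imI) ^ 2 + t ^ 2 * (x.imJ * y.imK - x.imK * y.imJ) ^ 2)
    set D := dilNormSq (t ^ 2) x * dilNormSq (t ^ 2) y
    have hD : 0 ≤ D := mul_nonneg (dilNormSq_nonneg ht2.le x) (dilNormSq_nonneg ht2.le y)
    have hA : 0 ≤ A := by positivity
    rcases hD.eq_or_lt with hD0 | hDpos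
    · -- degenerate: `D = 0` forces `x = 0` or `y = 0`, hence `A = 0`
      rw [← hD0, div_zero]
      have hA0 : A = 0 := by
        have hxy0 : dilNormSq (t ^ 2) x = 0 ∨ dilNormSq (t ^ 2) y = 0 := mul_eq_zero.1 hD0.symm
        rcases hxy0 with h0 | h0
        · obtain ⟨-, h1, h2, h3⟩ := coords_eq_zero_of_dilNormSq_eq_zero ht2 h0
          simp [A, h1, h2, h3]
        · obtain ⟨-, h1, h2, h3⟩ := coords_eq_zero_of_dilNormSq_eq_zero ht2 h0
          simp [A, h1, h2, h3]
      rw [hA0]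
      exact ⟨fun _ => le_refl _, fun _ => ht2.le⟩
    · rw [div_le_iff₀ hDpos]
      constructor
      · intro h; nlinarith
      · intro h; nlinarith
  have hxa : ∀ z : ℍ, commSq (dilate t z) a ≤ t ^ 2 ↔ 4 * (a.imI ^ 2 * (z.imJ ^ 2 + z.imK ^ 2)) ≤ dilNormSq (t ^ 2) z * ‖a‖ ^ 2 := by
    intro z
    have hNz : ‖dilate t z‖ ^ 2 = dilNormSq (t ^ 2) z := (dilNormSq_sq_eq t z).symm
    rw [commSq_def, norm_comm_axis_sq _ _ hJ hK, dilate_imJ, dilate_imK, hNz]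
    set A := 4 * (a.imI ^ 2 * (z.imJ ^ 2 + z.imK ^ 2))
    set D := dilNormSq (t ^ 2) z * ‖a‖ ^ 2
    have hD : 0 ≤ D := mul_nonneg (dilNormSq_nonneg ht2.le z) (sq_nonneg _)
    have hnum : 4 * (a.imI ^ 2 * ((t * z.imJ) ^ 2 + (t * z.imK) ^ 2)) = t ^ 2 * A := by simp only [A]; ring
    rw [hnum]
    rcases hD.eq_or_lt with hD0 | hDpos
    · rw [← hD0, div_zero]
      have hA0 : A = 0 := by
        rcases mul_eq_zero.1 hD0.symm with h0 | h0
        · obtain ⟨-, -, h2, h3⟩ := coords_eq_zero_of_dilNormSq_eq_zero ht2 h0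
          simp [A, h2, h3]
        · have ha0 : a = 0 := by
            have : ‖a‖ = 0 := by nlinarith [norm_nonneg a]
            exact norm_eq_zero.1 this
          simp [A, ha0]
      rw [hA0]
      exact ⟨fun _ => le_refl _, fun _ => ht2.le⟩
    · rw [div_le_iff₀ hDpos]
      constructor
      · intro h; nlinarith
      · intro h; nlinarith
  rw [hballx, hbally]
  simp only [conePairSet, rescaledSet, Set.mem_setOf_eq]
  rw [hxy, hxa x, hxa y]
  tauto

/-- ★★ **THE EXACT `t⁴`-SCALING** at an axis hub: for `t > 0` and `a_J = a_K = 0`,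
`φ_t(a) = coneConst²·t⁴·∫∫ 𝟙_{rescaledSet t² a}(x, y) dx dy` — the Jacobian `t⁴` of the two transverse dilations `D_t` is exactly the
small-ball order, and what is left is a `t`-regular event. [folklore] -/
theorem phiCone_axis_eq_scaled {t : ℝ} (ht : 0 < t) {a : ℍ} (hJ : a.imJ = 0) (hK : a.imK = 0) :
    phiCone t a = ENNReal.ofReal coneConst * (ENNReal.ofReal coneConst * (ENNReal.ofReal (t ^ 2) * (ENNReal.ofReal (t ^ 2) *
      ∫⁻ x, ∫⁻ y, (rescaledSet (t ^ 2) a).indicator (1 : ℍ × ℍ → ℝ≥0∞) (x, y)))) := by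
  have ht0 : t ≠ 0 := ht.ne'
  have hD : Measurable (dilate t) := (LinearMap.continuous_of_finiteDimensional _).measurable
  have hS := measurableSet_conePairSet t a
  have hF : Measurable fun p : ℍ × ℍ => (conePairSet t a).indicator (1 : ℍ × ℍ → ℝ≥0∞) p := measurable_one.indicator hS
  -- inner dilation
  have hGy : ∀ x : ℍ, Measurable fun y => (Metric.ball (0 : ℍ) 1).indicator (fun y => (conePairSet t a).indicator (1 : ℍ × ℍ → ℝ≥0∞) (x, y)) y :=
    fun x => (hF.comp (measurable_const.prodMk measurable_id)).indicator measurableSet_ball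
  have hinner : ∀ x : ℍ, ∫⁻ y, (Metric.ball (0 : ℍ) 1).indicator (fun y => (conePairSet t a).indicator (1 : ℍ × ℍ → ℝ≥0∞) (x, y)) y =
      ENNReal.ofReal (t ^ 2) * ∫⁻ y, (Metric.ball (0 : ℍ) 1).indicator (fun y => (conePairSet t a).indicator (1 : ℍ × ℍ → ℝ≥0∞) (x, y)) (dilate t y) :=
    fun x => lintegral_eq_sq_mul_lintegral_comp_dilate ht0 _ (hGy x)
  -- the integrand after both dilations is the indicator of the rescaled set
  have hpt : ∀ x y : ℍ, (Metric.ball (0 : ℍ) 1).indicator (fun x => (Metric.ball (0 : ℍ) 1).indicator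
      (fun y => (conePairSet t a).indicator (1 : ℍ × ℍ → ℝ≥0∞) (x, y)) (dilate t y)) (dilate t x) =
        (rescaledSet (t ^ 2) a).indicator (1 : ℍ × ℍ → ℝ≥0∞) (x, y) := by
    intro x y
    have key := dilate_mem_conePairSet_iff ht hJ hK x y
    by_cases h : (x, y) ∈ rescaledSet (t ^ 2) a
    · obtain ⟨h1, h2, h3⟩ := key.2 h
      rw [Set.indicator_of_mem h, Set.indicator_of_mem h1, Set.indicator_of_mem h2, Set.indicator_of_mem h3]
      rfl
    · rw [Set.indicator_of_notMem h]
      by_cases h1 : dilate t x ∈ Metric.ball (0 : ℍ) 1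
      · rw [Set.indicator_of_mem h1]
        by_cases h2 : dilate t y ∈ Metric.ball (0 : ℍ) 1
        · rw [Set.indicator_of_mem h2, Set.indicator_of_notMem]
          exact fun h3 => h (key.1 ⟨h1, h2, h3⟩)
        · rw [Set.indicator_of_notMem h2]
      · rw [Set.indicator_of_notMem h1]
  -- measurability of the outer integrand after the inner dilation
  -- assemble: outer dilation
  rw [phiCone_eq_lintegral_lintegral]
  simp_rw [hinner]
  have hpull : (fun x => (Metric.ball (0 : ℍ) 1).indicator (fun x => ENNReal.ofReal (t ^ 2) *
      ∫⁻ y, (Metric.ball (0 : ℍ) 1).indicator (fun y => (conePairSet t a).indicator (1 : ℍ × ℍ → ℝ≥0∞) (x, y)) (dilate t y)) x) =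
      fun x => ENNReal.ofReal (t ^ 2) * (Metric.ball (0 : ℍ) 1).indicator (fun x => ∫⁻ y, (Metric.ball (0 : ℍ) 1).indicator
        (fun y => (conePairSet t a).indicator (1 : ℍ × ℍ → ℝ≥0∞) (x, y)) (dilate t y)) x := by
    funext x
    exact Set.indicator_const_mul _ _ _ _
  -- the outer integrand, precomposed with the dilation, is `x ↦ ∫ 𝟙_R(x, y) dy`
  have hcomp : ∀ x : ℍ, (Metric.ball (0 : ℍ) 1).indicator (fun x => ∫⁻ y, (Metric.ball (0 : ℍ) 1).indicator
      (fun y => (conePairSet t a).indicator (1 : ℍ × ℍ → ℝ≥0∞) (x, y)) (dilate t y)) (dilate t x) =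
        ∫⁻ y, (rescaledSet (t ^ 2) a).indicator (1 : ℍ × ℍ → ℝ≥0∞) (x, y) := by
    intro x
    by_cases h1 : dilate t x ∈ Metric.ball (0 : ℍ) 1
    · rw [Set.indicator_of_mem h1]
      refine lintegral_congr fun y => ?_
      have := hpt x y
      rw [Set.indicator_of_mem h1] at this
      exact this
    · rw [Set.indicator_of_notMem h1]
      have h0 : ∀ y, (rescaledSet (t ^ 2) a).indicator (1 : ℍ × ℍ → ℝ≥0∞) (x, y) = 0 := by
        intro y
        have := hpt x y
        rw [Set.indicator_of_notMem h1] at this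
        exact this.symm
      rw [show (fun y => (rescaledSet (t ^ 2) a).indicator (1 : ℍ × ℍ → ℝ≥0∞) (x, y)) = fun _ => 0 from funext h0, lintegral_zero]
  -- measurability of the pre-dilation outer integrand
  have hK1 : Measurable fun p : ℍ × ℍ => (Metric.ball (0 : ℍ) 1).indicator
      (fun y => (conePairSet t a).indicator (1 : ℍ × ℍ → ℝ≥0∞) (p.1, y)) (dilate t p.2) := by
    have e : (fun p : ℍ × ℍ => (Metric.ball (0 : ℍ) 1).indicator (fun y => (conePairSet t a).indicator (1 : ℍ × ℍ → ℝ≥0∞) (p.1, y)) (dilate t p.2)) =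
        ((fun p : ℍ × ℍ => dilate t p.2) ⁻¹' Metric.ball (0 : ℍ) 1).indicator
          (fun p : ℍ × ℍ => (conePairSet t a).indicator (1 : ℍ × ℍ → ℝ≥0∞) (p.1, dilate t p.2)) := by
      funext p
      by_cases hp : dilate t p.2 ∈ Metric.ball (0 : ℍ) 1
      · rw [Set.indicator_of_mem hp, Set.indicator_of_mem (show p ∈ _ from hp)]
      · rw [Set.indicator_of_notMem hp, Set.indicator_of_notMem (show p ∉ _ from hp)]
    rw [e]
    exact (hF.comp (measurable_fst.prodMk (hD.comp measurable_snd))).indicator (measurableSet_ball.preimage (hD.comp measurable_snd))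
  have hK2 : Measurable fun x : ℍ => ∫⁻ y, (Metric.ball (0 : ℍ) 1).indicator
      (fun y => (conePairSet t a).indicator (1 : ℍ × ℍ → ℝ≥0∞) (x, y)) (dilate t y) := hK1.lintegral_prod_right'
  have houter := lintegral_eq_sq_mul_lintegral_comp_dilate ht0 _ (hK2.indicator (measurableSet_ball : MeasurableSet (Metric.ball (0 : ℍ) 1)))
  rw [hpull, lintegral_const_mul _ (hK2.indicator (measurableSet_ball : MeasurableSet (Metric.ball (0 : ℍ) 1))), houter]
  simp_rw [hcomp]

/-- The rescaled event at the axis hub is jointly measurable in `(a, x, y)`. [folklore] -/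
theorem measurableSet_rescaledSet_axis_joint (s : ℝ) :
    MeasurableSet {q : ℍ × ℍ × ℍ | (q.2.1, q.2.2) ∈ rescaledSet s (axisPoint q.1)} := by
  -- coordinates as measurable functions of `q = (a, x, y)`
  have hx : Measurable fun q : ℍ × ℍ × ℍ => q.2.1 := measurable_fst.comp measurable_snd
  have hy : Measurable fun q : ℍ × ℍ × ℍ => q.2.2 := measurable_snd.comp measurable_snd
  have hN1 : Measurable fun q : ℍ × ℍ × ℍ => dilNormSq s q.2.1 := (continuous_dilNormSq s).measurable.comp hx
  have hN2 : Measurable fun q : ℍ × ℍ × ℍ => dilNormSq s q.2.2 := (continuous_dilNormSq s).measurable.comp hy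
  have hm : Measurable fun q : ℍ × ℍ × ℍ => (axisPoint q.1).imI := by
    have : (fun q : ℍ × ℍ × ℍ => (axisPoint q.1).imI) = fun q => ‖q.1.im‖ := rfl
    rw [this]
    exact (continuous_norm.comp (Quaternion.continuous_im.comp continuous_fst)).measurable
  have hna : Measurable fun q : ℍ × ℍ × ℍ => ‖axisPoint q.1‖ ^ 2 := by
    have hc : Continuous fun a : ℍ => axisPoint a :=
      continuous_quat_mk Quaternion.continuous_re (continuous_norm.comp Quaternion.continuous_im) continuous_const continuous_const
    exact ((continuous_norm.comp (hc.comp continuous_fst)).pow 2).measurable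
  have hI1 : Measurable fun q : ℍ × ℍ × ℍ => q.2.1.imI := Quaternion.continuous_imI.measurable.comp hx
  have hJ1 : Measurable fun q : ℍ × ℍ × ℍ => q.2.1.imJ := Quaternion.continuous_imJ.measurable.comp hx
  have hK1 : Measurable fun q : ℍ × ℍ × ℍ => q.2.1.imK := Quaternion.continuous_imK.measurable.comp hx
  have hI2 : Measurable fun q : ℍ × ℍ × ℍ => q.2.2.imI := Quaternion.continuous_imI.measurable.comp hy
  have hJ2 : Measurable fun q : ℍ × ℍ × ℍ => q.2.2.imJ := Quaternion.continuous_imJ.measurable.comp hy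
  have hK2 : Measurable fun q : ℍ × ℍ × ℍ => q.2.2.imK := Quaternion.continuous_imK.measurable.comp hy
  have hc1 : Measurable fun q : ℍ × ℍ × ℍ => 4 * ((axisPoint q.1).imI ^ 2 * (q.2.1.imJ ^ 2 + q.2.1.imK ^ 2)) :=
    (((hm.pow_const 2).mul ((hJ1.pow_const 2).add (hK1.pow_const 2))).const_mul _)
  have hc2 : Measurable fun q : ℍ × ℍ × ℍ => 4 * ((axisPoint q.1).imI ^ 2 * (q.2.2.imJ ^ 2 + q.2.2.imK ^ 2)) :=
    (((hm.pow_const 2).mul ((hJ2.pow_const 2).add (hK2.pow_const 2))).const_mul _)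
  have hc3 : Measurable fun q : ℍ × ℍ × ℍ => 4 * ((q.2.1.imK * q.2.2.imI - q.2.1.imI * q.2.2.imK) ^ 2 +
      (q.2.1.imI * q.2.2.imJ - q.2.1.imJ * q.2.2.imI) ^ 2 + s * (q.2.1.imJ * q.2.2.imK - q.2.1.imK * q.2.2.imJ) ^ 2) :=
    (((((hK1.mul hI2).sub (hI1.mul hK2)).pow_const 2).add (((hI1.mul hJ2).sub (hJ1.mul hI2)).pow_const 2)).add
      ((((hJ1.mul hK2).sub (hK1.mul hJ2)).pow_const 2).const_mul s)).const_mul _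
  have e : {q : ℍ × ℍ × ℍ | (q.2.1, q.2.2) ∈ rescaledSet s (axisPoint q.1)} =
      {q | dilNormSq s q.2.1 < 1} ∩ ({q | dilNormSq s q.2.2 < 1} ∩
        ({q | 4 * ((axisPoint q.1).imI ^ 2 * (q.2.1.imJ ^ 2 + q.2.1.imK ^ 2)) ≤ dilNormSq s q.2.1 * ‖axisPoint q.1‖ ^ 2} ∩
          ({q | 4 * ((axisPoint q.1).imI ^ 2 * (q.2.2.imJ ^ 2 + q.2.2.imK ^ 2)) ≤ dilNormSq s q.2.2 * ‖axisPoint q.1‖ ^ 2} ∩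
            {q | 4 * ((q.2.1.imK * q.2.2.imI - q.2.1.imI * q.2.2.imK) ^ 2 + (q.2.1.imI * q.2.2.imJ - q.2.1.imJ * q.2.2.imI) ^ 2 +
              s * (q.2.1.imJ * q.2.2.imK - q.2.1.imK * q.2.2.imJ) ^ 2) ≤ dilNormSq s q.2.1 * dilNormSq s q.2.2}))) := by
    ext q; simp only [rescaledSet, Set.mem_setOf_eq, Set.mem_inter_iff]
  rw [e]
  exact (measurableSet_lt hN1 measurable_const).inter ((measurableSet_lt hN2 measurable_const).inter
    ((measurableSet_le hc1 (hN1.mul hna)).inter ((measurableSet_le hc2 (hN2.mul hna)).inter (measurableSet_le hc3 (hN1.mul hN2)))))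

/-- The hub function `a ↦ ∫∫ 𝟙_{G_s(axisPoint a)}` is measurable. [folklore] -/
theorem measurable_lintegral_rescaledSet_axis (s : ℝ) :
    Measurable fun a : ℍ => ∫⁻ x, ∫⁻ y, (rescaledSet s (axisPoint a)).indicator (1 : ℍ × ℍ → ℝ≥0∞) (x, y) := by
  have h3 : Measurable fun q : (ℍ × ℍ) × ℍ => (rescaledSet s (axisPoint q.1.1)).indicator (1 : ℍ × ℍ → ℝ≥0∞) (q.1.2, q.2) := by
    have e : (fun q : (ℍ × ℍ) × ℍ => (rescaledSet s (axisPoint q.1.1)).indicator (1 : ℍ × ℍ → ℝ≥0∞) (q.1.2, q.2)) =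
        ((fun q : (ℍ × ℍ) × ℍ => (q.1.1, q.1.2, q.2)) ⁻¹' {q : ℍ × ℍ × ℍ | (q.2.1, q.2.2) ∈ rescaledSet s (axisPoint q.1)}).indicator 1 := by
      funext q
      rfl
    rw [e]
    refine measurable_one.indicator ((measurableSet_rescaledSet_axis_joint s).preimage ?_)
    exact (measurable_fst.comp measurable_fst).prodMk ((measurable_snd.comp measurable_fst).prodMk measurable_snd)
  have h2 : Measurable fun p : ℍ × ℍ => ∫⁻ y, (rescaledSet s (axisPoint p.1)).indicator (1 : ℍ × ℍ → ℝ≥0∞) (p.2, y) :=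
    h3.lintegral_prod_right'
  exact h2.lintegral_prod_right'

/-- ★★ **`Haar³(N₃(t)) = t⁴ · coneConst² · ∫ dcone(a) ∫∫ 𝟙_{G_{t²}(re a + ‖Im a‖·i)}(x, y) dx dy`** for `t > 0` — the small-ball order `t⁴` EXACTLY
factored out; the remaining integral is over a `t`-regular event (part II: it converges as `t → 0`). [folklore] -/
theorem haar_tripleBall_eq_scaled {t : ℝ} (ht : 0 < t) :
    (Measure.pi fun _ : Fin 3 => haarProbability (Matrix.specialUnitaryGroup (Fin 2) ℂ)) (tripleBall t) =
      ENNReal.ofReal (t ^ 4) * (ENNReal.ofReal coneConst * (ENNReal.ofReal coneConst *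
        ∫⁻ a, (∫⁻ x, ∫⁻ y, (rescaledSet (t ^ 2) (axisPoint a)).indicator (1 : ℍ × ℍ → ℝ≥0∞) (x, y)) ∂coneMeasure)) := by
  rw [haar_tripleBall_eq_lintegral_axis ht.le]
  have hax : ∀ a : ℍ, phiCone t (axisPoint a) = ENNReal.ofReal (t ^ 4) * (ENNReal.ofReal coneConst * (ENNReal.ofReal coneConst *
      ∫⁻ x, ∫⁻ y, (rescaledSet (t ^ 2) (axisPoint a)).indicator (1 : ℍ × ℍ → ℝ≥0∞) (x, y))) := by
    intro a
    rw [phiCone_axis_eq_scaled ht (axisPoint_components a).2.2.1 (axisPoint_components a).2.2.2]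
    have e4 : ENNReal.ofReal (t ^ 4) = ENNReal.ofReal (t ^ 2) * ENNReal.ofReal (t ^ 2) := by
      rw [← ENNReal.ofReal_mul (sq_nonneg _)]; ring_nf
    rw [e4]
    ring
  simp_rw [hax]
  -- pull the constants out of the hub integral
  have hmeas : Measurable fun a : ℍ => ∫⁻ x, ∫⁻ y, (rescaledSet (t ^ 2) (axisPoint a)).indicator (1 : ℍ × ℍ → ℝ≥0∞) (x, y) :=
    measurable_lintegral_rescaledSet_axis (t ^ 2)
  rw [lintegral_const_mul (ENNReal.ofReal (t ^ 4)) ((hmeas.const_mul _).const_mul _),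
    lintegral_const_mul (ENNReal.ofReal coneConst) (hmeas.const_mul _), lintegral_const_mul (ENNReal.ofReal coneConst) hmeas]

end Summit.QuantumFields.YangMills.Theorems.SwapVirialDeficit.ZeroModeGroup

end
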